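import Mathlib
import Summits.NavierStokesRegularity.NavierStokesRegularity.Theorems.EulerZoomLiouvillePowerGaugeEulerLiouvilleCondenserMinimalType
import Summits.NavierStokesRegularity.NavierStokesRegularity.Theorems.EulerZoomLiouvillePowerGaugeEulerLiouvilleNeedleClockPast
import Summits.NavierStokesRegularity.NavierStokesRegularity.Theorems.EulerZoomLiouvillePowerGaugeEulerLiouvilleSelfSimilarPastStrata

/-!
# MINIMAL EXPONENTIAL TYPE AT THE CRITICAL ORDER KILLS — profile-level core and the PAST TWIN (KEY «C-MIN», past disjunct)

Width piece for crux `EulerZoomLiouville.PowerGaugeEulerLiouville` (stmt-NavierStokesRegularity-19832), by name under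
LEAD 19832 (ns-typeII-p2 g12); seat ns-ezl-w2 g3, `--supports stmt-NavierStokesRegularity-19832 --as helper`.

* **`curl_eq_zero_of_minimalTypeGradient`** — the PROFILE-LEVEL core of `…CondenserMinimalType` (factored out): a self-similar
  Euler profile `(V, P')` with clock `1/(2+ρ)`, `V ∈ C²`, ball budgets `∫_{B(0,3R)}‖V‖² ≤ C_A(3R)^{1−2ρ}`, `∫_{B(0,3R)}‖DV‖² ≤ C_E(3R)^{1−ρ}`
  (`R ≥ 1`) and MINIMAL LOWER exponential TYPE of `‖DV‖` at order `2+ρ` is IRROTATIONAL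
  [t44-B `exists_gradient_ge_exp_rpow_of_exit` + cut-off no-exit + `Loc.volume_vortical_confined_eq_zero`].
* **`selfSimilar_ae_eq_zero_of_minimalTypeGradientC2_past`** — the PAST TWIN of `selfSimilar_ae_eq_zero_of_minimalTypeGradientC2`
  (binder prefix of ns-ezl-w4 g4's p648147 verbatim: `hT₁ hTT₁ x₀ hsw hH hgauge hu hp hV` + `hgrad`): a member that is exactly
  self-similar below a time `T₁ ≤ 0` about `(x₀, T)` with a `C²` profile of minimal lower gradient type is trivial
  [`NeedleRace.needleBudgets_of_selfSimilarC2_past` + `Past.exists_isSelfSimilarEulerProfile` + the core +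
  `Past.profile_eq_zero_of_irrotationalC2` + `Past.ae_eq_zero_of_profile_eq_zero`].

HONEST FRAMING: strata of the crux CLASS (hypothetical blow-up members); nothing here proves the crux E `PowerGaugeEulerLiouville`
(19832 OPEN), any door Target, or Navier–Stokes regularity; MODEL lattice only.  [cite: ConstantinIgnatovaVicol2026Putative, §3.4.1]
-/

noncomputable section

open Set Filter Topology Metric Function MeasureTheory Real
open scoped RealInnerProductSpace NNReal ENNReal

set_option linter.dupNamespace false

namespace Summit.NavierStokesRegularity.NavierStokesRegularity.Theorems.PowerGaugeEulerLiouville.Condenser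

open Literature.Analysis Literature.Analysis.FluidPDE
open Summit.NavierStokesRegularity.NavierStokesRegularity.Theorems.PowerGaugeEulerLiouville

/-- **PROFILE-LEVEL CORE: minimal lower exponential type of the gradient forces irrotationality.**  See the module docstring.
[cite: ConstantinIgnatovaVicol2026Putative, §3.4.1; folklore (length–area method)] -/
theorem curl_eq_zero_of_minimalTypeGradient {ρ : ℝ} (hρ : 0 < ρ) (hρ1 : ρ ≤ 1 / 2)
    {V : EuclideanSpace ℝ (Fin 3) → EuclideanSpace ℝ (Fin 3)} {P' : EuclideanSpace ℝ (Fin 3) → ℝ}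
    (hprof : IsSelfSimilarEulerProfile (1 / (2 + ρ)) 0 V P') (hV : ContDiff ℝ 2 V)
    {CA CE : ℝ} (hCApos : 0 < CA) (hCEpos : 0 < CE)
    (hbA : ∀ R : ℝ, 1 ≤ R →
      ∫ x in ball (0 : EuclideanSpace ℝ (Fin 3)) (3 * R), ‖V x‖ ^ 2 ≤ CA * (3 * R) ^ (1 - 2 * ρ))
    (hbE : ∀ R : ℝ, 1 ≤ R →
      ∫ x in ball (0 : EuclideanSpace ℝ (Fin 3)) (3 * R), ‖fderiv ℝ V x‖ ^ 2 ≤ CE * (3 * R) ^ (1 - ρ))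
    (hgrad : ∀ c' : ℝ, 0 < c' → ∀ R₀ : ℝ, ∃ R : ℝ, R₀ ≤ R ∧
      ∀ z ∈ ball (0 : EuclideanSpace ℝ (Fin 3)) (3 * R), ‖fderiv ℝ V z‖ ≤ Real.exp (c' * R ^ (2 + ρ))) :
    ∀ x : EuclideanSpace ℝ (Fin 3), curl V x = 0 := by
  have h2ρ : (0 : ℝ) < 2 + ρ := by linarith
  have hγ : (0 : ℝ) < 1 / (2 + ρ) := one_div_pos.2 h2ρ
  have hγ2 : 1 / (2 + ρ) < 1 / 2 := one_div_lt_one_div_of_lt two_pos (by linarith)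
  -- ### THEOREM B in gauge form (t44-B), and the exponent split
  obtain ⟨R₁, hR₁, hB⟩ := exists_gradient_ge_exp_rpow_of_exit (γ := 1 / (2 + ρ)) (ρ := ρ) hγ hρ.le hCApos hCEpos
  set κ : ℝ := Real.pi * (1 / (2 + ρ)) ^ 2 / (128 * (3 : ℝ) ^ (1 - ρ) * CE) with hκ
  have hκpos : 0 < κ := by
    have : 0 < (3 : ℝ) ^ (1 - ρ) := Real.rpow_pos_of_pos (by norm_num) _
    rw [hκ]; positivity
  set c' : ℝ := κ / 2 with hc'
  have hc'pos : 0 < c' := by positivity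
  set Rlog : ℝ := 2 * (Real.log (2 / (1 / (2 + ρ))) + 1) / κ with hRlog
  -- ### the profile is irrotational
  have hcurl : ∀ x : EuclideanSpace ℝ (Fin 3), curl V x = 0 := by
    intro x
    by_contra hx
    -- a radius handed out by the hypothesis
    obtain ⟨R, hR, hgradR⟩ := hgrad c' hc'pos (max (max R₁ 1) (max (‖x‖ + 1) Rlog))
    have hRR₁ : R₁ ≤ R := ((le_max_left _ _).trans (le_max_left _ _)).trans hR
    have hR1 : 1 ≤ R := ((le_max_right _ _).trans (le_max_left _ _)).trans hR
    have hRx : ‖x‖ + 1 ≤ R := ((le_max_left _ _).trans (le_max_right _ _)).trans hR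
    have hRlogR : Rlog ≤ R := ((le_max_right _ _).trans (le_max_right _ _)).trans hR
    have hR0 : 0 < R := by linarith
    -- a `C²` cut-off copy agreeing with `V` on `ball 0 (3R)`
    obtain ⟨Vc, hVc2, -, -, ⟨K, hK⟩, hVU⟩ := Loc.exists_cutoff_local hV (R := 3 * R) (by positivity)
    have hVc1 : ContDiff ℝ 1 Vc := hVc2.of_le (by norm_num)
    have hfd : ∀ z ∈ ball (0 : EuclideanSpace ℝ (Fin 3)) (3 * R), fderiv ℝ Vc z = fderiv ℝ V z := fun z hz =>
      Filter.EventuallyEq.fderiv_eq (Filter.eventually_of_mem (isOpen_ball.mem_nhds hz) hVU)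
    have hAc : ∫ z in ball (0 : EuclideanSpace ℝ (Fin 3)) (3 * R), ‖Vc z‖ ^ 2 ≤ CA * (3 * R) ^ (1 - 2 * ρ) := by
      rw [setIntegral_congr_fun measurableSet_ball (fun z hz => by rw [hVU z hz])]
      exact hbA R hR1
    have hEc : ∫ z in ball (0 : EuclideanSpace ℝ (Fin 3)) (3 * R), ‖fderiv ℝ Vc z‖ ^ 2 ≤ CE * (3 * R) ^ (1 - ρ) := by
      rw [setIntegral_congr_fun measurableSet_ball (fun z hz => by rw [hfd z hz])]
      exact hbE R hR1
    -- NO EXIT at this scale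
    have hnoexit : ∀ y : EuclideanSpace ℝ (Fin 3), ‖y‖ < R → ∀ L : ℝ, 0 ≤ L →
        ‖ODE.evolutionMap (fun _ : ℝ => selfSimilarTransport (1 / (2 + ρ)) 0 Vc) 0 (-L) y‖ < 2 * R := by
      intro y hy L hL
      by_contra hex
      push Not at hex
      obtain ⟨z, hz, hzle⟩ := hB Vc K hVc1 hK R hRR₁ hAc hEc y L hL hy hex
      rw [hfd z hz] at hzle
      have h1 := hzle.trans (hgradR z hz)
      -- `γ/2 · e^{κ R^{2+ρ}} ≤ e^{(κ/2) R^{2+ρ}}` is impossible for `R ≥ Rlog`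
      have hRpow : R ≤ R ^ (2 + ρ) := by
        have : R ^ (1 : ℝ) ≤ R ^ (2 + ρ) := Real.rpow_le_rpow_of_exponent_le hR1 (by linarith)
        rwa [Real.rpow_one] at this
      have h2 : Real.log (2 / (1 / (2 + ρ))) + 1 ≤ c' * R ^ (2 + ρ) := by
        have h3 : Real.log (2 / (1 / (2 + ρ))) + 1 = c' * Rlog := by
          rw [hc', hRlog]; field_simp
        rw [h3]
        exact mul_le_mul_of_nonneg_left (hRlogR.trans hRpow) hc'pos.le
      have hκc : κ = c' + c' := by rw [hc']; ring
      have h4 : 1 / (2 + ρ) / 2 * Real.exp (κ * R ^ (2 + ρ)) =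
          (1 / (2 + ρ) / 2 * Real.exp (c' * R ^ (2 + ρ))) * Real.exp (c' * R ^ (2 + ρ)) := by
        rw [hκc, add_mul, Real.exp_add]; ring
      rw [h4] at h1
      have h5 : 1 / (2 + ρ) / 2 * Real.exp (c' * R ^ (2 + ρ)) ≤ 1 :=
        le_of_mul_le_mul_right (by simpa using h1) (Real.exp_pos _)
      -- but `e^{c' R^{2+ρ}} ≥ e · (2/γ)`
      have h6 : Real.exp (Real.log (2 / (1 / (2 + ρ))) + 1) ≤ Real.exp (c' * R ^ (2 + ρ)) := Real.exp_le_exp.2 h2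
      rw [Real.exp_add, Real.exp_log (by positivity)] at h6
      have h7 : (1 : ℝ) < Real.exp 1 := by
        have := Real.add_one_lt_exp (by norm_num : (1 : ℝ) ≠ 0)
        linarith
      have hγ' : 0 < 1 / (2 + ρ) / 2 := by positivity
      have h8 : 1 / (2 + ρ) / 2 * (2 / (1 / (2 + ρ)) * Real.exp 1) ≤
          1 / (2 + ρ) / 2 * Real.exp (c' * R ^ (2 + ρ)) := mul_le_mul_of_nonneg_left h6 hγ'.le
      have h9 : 1 / (2 + ρ) / 2 * (2 / (1 / (2 + ρ)) * Real.exp 1) = Real.exp 1 := by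
        field_simp
      linarith
    -- CONFINEMENT: every vortical point of `B(0,R)` has a backward `V`-trajectory staying in `B̄(0,2R)`
    have hnull := Loc.volume_vortical_confined_eq_zero hprof hγ hγ2 (N := 2 * R) (by positivity)
    set O : Set (EuclideanSpace ℝ (Fin 3)) := ball 0 R ∩ {x' | curl V x' ≠ 0} with hO
    have hOopen : IsOpen O :=
      isOpen_ball.inter (isOpen_ne_fun (differentiable_curl_of_contDiff hV).continuous continuous_const)
    have hxO : x ∈ O := ⟨mem_ball_zero_iff.2 (by linarith), hx⟩
    have hOsub : O ⊆ {x' : EuclideanSpace ℝ (Fin 3) | curl V x' ≠ 0 ∧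
        ∃ Y : ℝ → EuclideanSpace ℝ (Fin 3), Y 0 = x' ∧
          (∀ t, 0 ≤ t → HasDerivAt Y ((-1 : ℝ) • selfSimilarTransport (1 / (2 + ρ)) 0 V (Y t)) t) ∧
          ∀ t, 0 ≤ t → ‖Y t‖ ≤ 2 * R} := by
      rintro x' ⟨hx'R, hx'c⟩
      refine ⟨hx'c, fun t => ODE.evolutionMap (fun _ : ℝ => selfSimilarTransport (1 / (2 + ρ)) 0 Vc) 0 (-t) x',
        ?_, ?_, ?_⟩
      · simp [ODE.evolutionMap_self]
      · intro t ht
        have h := C2.Kelvin.hasDerivAt_flow_neg (γ := 1 / (2 + ρ)) hVc1 hK x' t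
        have hin : ODE.evolutionMap (fun _ : ℝ => selfSimilarTransport (1 / (2 + ρ)) 0 Vc) 0 (-t) x' ∈
            ball (0 : EuclideanSpace ℝ (Fin 3)) (3 * R) :=
          mem_ball_zero_iff.2 ((hnoexit x' (mem_ball_zero_iff.1 hx'R) t ht).trans (by linarith))
        have hW : selfSimilarTransport (1 / (2 + ρ)) 0 Vc
              (ODE.evolutionMap (fun _ : ℝ => selfSimilarTransport (1 / (2 + ρ)) 0 Vc) 0 (-t) x') =
            selfSimilarTransport (1 / (2 + ρ)) 0 V
              (ODE.evolutionMap (fun _ : ℝ => selfSimilarTransport (1 / (2 + ρ)) 0 Vc) 0 (-t) x') := by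
          rw [selfSimilarTransport_apply, selfSimilarTransport_apply, hVU _ hin]
        rw [hW] at h
        exact h
      · intro t ht
        exact (hnoexit x' (mem_ball_zero_iff.1 hx'R) t ht).le
    have hO0 : volume O = 0 := measure_mono_null hOsub hnull
    exact (hOopen.measure_pos volume ⟨x, hxO⟩).ne' hO0
  exact hcurl

/-- **PAST TWIN of `selfSimilar_ae_eq_zero_of_minimalTypeGradientC2`** (KEY «C-MIN», past disjunct).  See the module docstring.
[cite: ConstantinIgnatovaVicol2026Putative, §3.4.1; folklore (length–area method)] -/
theorem selfSimilar_ae_eq_zero_of_minimalTypeGradientC2_past {ρ T T₁ : ℝ} (hρ : 0 < ρ) (hρ1 : ρ ≤ 1 / 2)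
    (hT₁ : T₁ ≤ 0) (hTT₁ : T₁ ≤ T) (x₀ : EuclideanSpace ℝ (Fin 3))
    {u : ℝ → EuclideanSpace ℝ (Fin 3) → EuclideanSpace ℝ (Fin 3)} {p : ℝ → EuclideanSpace ℝ (Fin 3) → ℝ}
    {H : ℝ → EuclideanSpace ℝ (Fin 3) → EuclideanSpace ℝ (Fin 3) →L[ℝ] EuclideanSpace ℝ (Fin 3)} {c : ℝ≥0}
    (hsw : IsSuitableWeakSolutionOn (slab (EuclideanSpace ℝ (Fin 3)) (Iio 0) isOpen_Iio) 0 0 u p)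
    (hH : HasWeakSpatialGradientOn (slab (EuclideanSpace ℝ (Fin 3)) (Iio 0) isOpen_Iio) u H)
    (hgauge : ∀ a : ℝ, 0 < a →
      ENNReal.ofReal (a ^ (2 * ρ)) * cknA a (0 : ℝ × EuclideanSpace ℝ (Fin 3)) u +
          ENNReal.ofReal (a ^ ρ) * cknE a (0 : ℝ × EuclideanSpace ℝ (Fin 3)) H +
        ENNReal.ofReal (a ^ (2 * ρ)) * cknD a (0 : ℝ × EuclideanSpace ℝ (Fin 3)) p ≤ (c : ℝ≥0∞))
    {V : EuclideanSpace ℝ (Fin 3) → EuclideanSpace ℝ (Fin 3)} {P : EuclideanSpace ℝ (Fin 3) → ℝ}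
    (hu : ∀ τ : ℝ, τ < T₁ → u τ = fun x => selfSimilarCollapse (1 / (2 + ρ)) T V τ (x - x₀))
    (hp : ∀ τ : ℝ, τ < T₁ → p τ = fun x => selfSimilarCollapsePressure (1 / (2 + ρ)) T P τ (x - x₀))
    (hV : ContDiff ℝ 2 V)
    (hgrad : ∀ c' : ℝ, 0 < c' → ∀ R₀ : ℝ, ∃ R : ℝ, R₀ ≤ R ∧
      ∀ z ∈ ball (0 : EuclideanSpace ℝ (Fin 3)) (3 * R), ‖fderiv ℝ V z‖ ≤ Real.exp (c' * R ^ (2 + ρ))) :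
    uncurry u =ᵐ[volume.restrict (Iio (0 : ℝ) ×ˢ (univ : Set (EuclideanSpace ℝ (Fin 3))))] 0 := by
  have hA : ∀ a : ℝ, 0 < a → ENNReal.ofReal (a ^ (2 * ρ)) *
      cknA a (0 : ℝ × EuclideanSpace ℝ (Fin 3)) u ≤ (c : ℝ≥0∞) :=
    fun a ha => le_trans (le_trans le_self_add le_self_add) (hgauge a ha)
  have hE : ∀ a : ℝ, 0 < a → ENNReal.ofReal (a ^ ρ) *
      cknE a (0 : ℝ × EuclideanSpace ℝ (Fin 3)) H ≤ (c : ℝ≥0∞) :=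
    fun a ha => le_trans (le_trans le_add_self le_self_add) (hgauge a ha)
  -- classical pressure for the profile and the closed-ball budgets from the far past
  obtain ⟨P', hprof⟩ := Past.exists_isSelfSimilarEulerProfile hρ hT₁ hTT₁ hsw.distributional hu hp hV
  obtain ⟨-, cA, cE, hcA, hcE, hbA, hbE⟩ :=
    NeedleRace.needleBudgets_of_selfSimilarC2_past hρ hρ1 hT₁ hTT₁ x₀ hsw.distributional hH hA hE hu hp hV
  -- real ball budgets at radius `3R`, `R ≥ 1`, with positive constants
  have hbA' : ∀ R : ℝ, 1 ≤ R →
      ∫ x in ball (0 : EuclideanSpace ℝ (Fin 3)) (3 * R), ‖V x‖ ^ 2 ≤ (cA + 1) * (3 * R) ^ (1 - 2 * ρ) := by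
    intro R hR
    have h3R1 : (1 : ℝ) ≤ 3 * R := by linarith
    have h3R0 : (0 : ℝ) < 3 * R := by linarith
    have h1 : ∫⁻ z in ball (0 : EuclideanSpace ℝ (Fin 3)) (3 * R), ‖V z‖ₑ ^ 2 ≤
        ENNReal.ofReal (cA * (3 * R) ^ (1 - 2 * ρ)) :=
      (lintegral_mono_set ball_subset_closedBall).trans (hbA (3 * R) h3R1)
    have hX : 0 ≤ (cA + 1) * (3 * R) ^ (1 - 2 * ρ) := by positivity
    refine setIntegral_sq_le_of_lintegral hV.continuous hX (h1.trans ?_)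
    exact ENNReal.ofReal_le_ofReal (by nlinarith [Real.rpow_nonneg h3R0.le (1 - 2 * ρ)])
  have hbE' : ∀ R : ℝ, 1 ≤ R →
      ∫ x in ball (0 : EuclideanSpace ℝ (Fin 3)) (3 * R), ‖fderiv ℝ V x‖ ^ 2 ≤ (cE + 1) * (3 * R) ^ (1 - ρ) := by
    intro R hR
    have h3R1 : (1 : ℝ) ≤ 3 * R := by linarith
    have h3R0 : (0 : ℝ) < 3 * R := by linarith
    have h1 : ∫⁻ z in ball (0 : EuclideanSpace ℝ (Fin 3)) (3 * R), ‖fderiv ℝ V z‖ₑ ^ 2 ≤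
        ENNReal.ofReal (cE * (3 * R) ^ (1 - ρ)) :=
      (lintegral_mono_set ball_subset_closedBall).trans (hbE (3 * R) h3R1)
    have hY : 0 ≤ (cE + 1) * (3 * R) ^ (1 - ρ) := by positivity
    refine setIntegral_sq_le_of_lintegral (hV.continuous_fderiv (by norm_num)) hY (h1.trans ?_)
    exact ENNReal.ofReal_le_ofReal (by nlinarith [Real.rpow_nonneg h3R0.le (1 - ρ)])
  have hc0 : ∀ x, curl V x = 0 :=
    curl_eq_zero_of_minimalTypeGradient hρ hρ1 hprof hV (by linarith) (by linarith) hbA' hbE' hgrad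
  exact Past.ae_eq_zero_of_profile_eq_zero hρ.le hsw hH hgauge hu
    (Past.profile_eq_zero_of_irrotationalC2 hρ hρ1 hT₁ hTT₁ hsw.distributional hA hu hp hV hc0)

end Summit.NavierStokesRegularity.NavierStokesRegularity.Theorems.PowerGaugeEulerLiouville.Condenser

end
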